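import Literature.NumberTheory.Transcendental.DerivationExtension
import Literature.NumberTheory.Transcendental.AxDerivationTools
import Literature.NumberTheory.Transcendental.RosenlichtDifferentials
import Literature.NumberTheory.Transcendental.ExpVarieties
import Literature.RingTheory.KrullDimension.AffineDimension
import HarnessLib

/-!
# Bays–Kirby 2018, Prop. 11.5 without Thm 11.4 — step 1: logarithmic points of `Γ`-points

Support file for a direct proof of the named fact
`Literature.NumberTheory.Transcendental.BaysKirby2018_prop_11_5` (M. Bays, J. Kirby,
*Pseudo-exponential maps, variants, and quasiminimality*, Algebra & Number Theory 12 (2018),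
Prop. 11.5: generic Γ-closedness over `K` implies generic strong Γ-closedness over `K`). The printed
proof invokes the horizontal semiabelian weak Zilber–Pink theorem (Thm 11.4, Fact 11.3). Here we
run Zilber's argument (Ax's theorem + compactness, Zilber 2002; Kirby 2009, Thm 4.3/4.6) directly on
the `K₀`-generic points `ζ` of the `K`-locus — the dependent Γ-points themselves — instead of on
the generic points of atypical components of a constructible family; this is what makes the
finiteness needed by Prop. 11.5 available without the uniform-in-families theorem.

This file builds, for a point `ζ ∈ F^{N ⊕ N}` with unit multiplicative coordinates and a subfield
`K₀ ⊆ F` (`char F = 0`), the differential field in which `ζ` becomes an exponential point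
(Kirby 2009, proof of Thm 4.6: "let `y` be generic in `X` over `C`, take logarithms `x` in a
differential field extension; `rk Jac = dim X`"):

* a transcendence basis of `K₀[ζ]` over `K₀` among the coordinates of `ζ` (`basisSet`, indices
  `basisIdx ζ ⊆ Fin N ⊕ Fin N`, `card_basisIdx`: their number is `dim K₀[X] ⧸ I_{K₀}(ζ) = td(ζ/K₀)`);
* dual `K₀`-derivations `∂ₐ` of `F` (`dualDerivation`), normalised so that the Jacobian of the
  "logarithmic coordinates" is the identity, and the constants lemma
  `isAlgebraic_of_forall_dualDerivation_eq_zero`: an element of `K₀(ζ)` killed by all `∂ₐ` is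
  algebraic over `K₀`;
* the field `LogF F N = F(x₁, …, x_N)` of formal logarithms (the SAME type for every `ζ`, which is
  what lets the compactness step use an ultrapower of a constant family), derivations
  `logDer K₀ ζ c` (`c ∈ Fin N ⊕ Fin N`) of `LogF F N` killing `K₀` with `D ζ₂ᵢ = ζ₂ᵢ D xᵢ`
  (`logDer_exp`), Jacobian the identity on the basis indices (`logDer_jac`), and constant Laurent
  monomials in `ζ₂` algebraic over `K₀` (`isAlgebraic_of_forall_logDer_prod_zpow`).

Everything here is folklore differential algebra (Rosenlicht 1976, Prop. 3) in the service of
[cite: BaysKirby2018ANT, Prop. 11.5]; cf. `WeakCITLogPoint.lean` (the same construction over `ℂ`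
for generic points of subvarieties of the torus).

## References

* M. Bays, J. Kirby, *Pseudo-exponential maps, variants, and quasiminimality*, ANT 12 (2018),
  Prop. 11.5.
* J. Kirby, *The theory of the exponential differential equations of semiabelian varieties*,
  Selecta Math. 15 (2009), Thm 4.3, Thm 4.6 (proof).
* M. Rosenlicht, *On Liouville's theory of elementary functions*, Pacific J. Math. 65 (1976),
  Prop. 3.
-/

noncomputable section

open MvPolynomial Set

universe u

namespace Literature.NumberTheory.Transcendental.Prop115

/-! ### A transcendence basis of `K₀[ζ]` among the coordinates -/

section Basis

variable {F : Type u} [Field F] (K₀ : Type u) [Field K₀] [Algebra K₀ F] {ι : Type} (ζ : ι → F)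

/-- The `K₀`-algebra `K₀[ζ] ⊆ F` generated by the coordinates of `ζ`. [folklore] -/
abbrev genAlg : Subalgebra K₀ F := Algebra.adjoin K₀ (range ζ)

/-- There is a transcendence basis of `K₀[ζ]` over `K₀` consisting of coordinates of `ζ`.
[folklore] -/
theorem exists_basisSet : ∃ u : Set (genAlg K₀ ζ), u ⊆ ((↑) : genAlg K₀ ζ → F) ⁻¹' range ζ ∧
    IsTranscendenceBasis K₀ ((↑) : u → genAlg K₀ ζ) := by
  set A : Subalgebra K₀ F := genAlg K₀ ζ with hA
  set t : Set A := ((↑) : A → F) ⁻¹' range ζ with ht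
  have htop : Algebra.adjoin K₀ t = ⊤ := by
    apply Subalgebra.map_injective (f := A.val) Subtype.val_injective
    rw [Algebra.map_top, Subalgebra.range_val, ← Algebra.adjoin_image, Subalgebra.coe_val,
      image_preimage_eq_inter_range]
    have hr : range ((↑) : A → F) = (A : Set F) := Subtype.range_coe
    rw [hr, inter_eq_left.mpr Algebra.subset_adjoin]
  haveI : Algebra.IsAlgebraic (Algebra.adjoin K₀ t) A := by
    rw [htop]
    exact ⟨fun a => isAlgebraic_algebraMap (⟨a, Algebra.mem_top⟩ : (⊤ : Subalgebra K₀ A))⟩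
  obtain ⟨u, -, hut, hu⟩ := exists_isTranscendenceBasis_between (R := K₀) (A := A) ∅ t
    (empty_subset _) ((algebraicIndependent_empty_iff K₀ A).mpr (algebraMap K₀ A).injective)
  exact ⟨u, hut, hu⟩

/-- A chosen transcendence basis of `K₀[ζ]` over `K₀` among the coordinates of `ζ`. [folklore] -/
def basisSet : Set (genAlg K₀ ζ) := (exists_basisSet K₀ ζ).choose

/-- The chosen basis consists of coordinates of `ζ`. [folklore] -/
theorem basisSet_subset : basisSet K₀ ζ ⊆ ((↑) : genAlg K₀ ζ → F) ⁻¹' range ζ :=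
  (exists_basisSet K₀ ζ).choose_spec.1

/-- The chosen basis is a transcendence basis of `K₀[ζ]`. [folklore] -/
theorem isTranscendenceBasis_basisSet :
    IsTranscendenceBasis K₀ ((↑) : basisSet K₀ ζ → genAlg K₀ ζ) :=
  (exists_basisSet K₀ ζ).choose_spec.2

/-- The basis viewed in `F`. [folklore] -/
def bvec (a : basisSet K₀ ζ) : F := ((a : genAlg K₀ ζ) : F)

/-- The basis is algebraically independent over `K₀` inside `F`. [folklore] -/
theorem algebraicIndependent_bvec : AlgebraicIndependent K₀ (bvec K₀ ζ) :=
  (isTranscendenceBasis_basisSet K₀ ζ).1.map' (f := (genAlg K₀ ζ).val) Subtype.val_injective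

/-- A chosen coordinate index for each basis element. [folklore] -/
def idx (a : basisSet K₀ ζ) : ι := (basisSet_subset K₀ ζ a.2).choose

/-- The chosen index recovers the basis element. [folklore] -/
theorem apply_idx (a : basisSet K₀ ζ) : ζ (idx K₀ ζ a) = bvec K₀ ζ a :=
  (basisSet_subset K₀ ζ a.2).choose_spec

/-- The index assignment is injective. [folklore] -/
theorem idx_injective : Function.Injective (idx K₀ ζ) := fun a b h => by
  apply Subtype.ext; apply Subtype.ext
  have ha := apply_idx K₀ ζ a
  have hb := apply_idx K₀ ζ b
  rw [h] at ha
  exact ha.symm.trans hb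

variable [Fintype ι]

/-- The basis is finite (it injects into the index type). [folklore] -/
instance fintypeBasisSet : Fintype (basisSet K₀ ζ) := by
  classical
  exact Fintype.ofInjective (idx K₀ ζ) (idx_injective K₀ ζ)

/-- The set of indices of the chosen transcendence basis. [folklore] -/
def basisIdx : Finset ι := by
  classical
  exact Finset.univ.image (idx K₀ ζ)

/-- Membership in `basisIdx`. [folklore] -/
theorem mem_basisIdx_iff {b : ι} : b ∈ basisIdx K₀ ζ ↔ b ∈ range (idx K₀ ζ) := by
  classical
  simp [basisIdx]

/-- The number of basis indices is the size of the basis. [folklore] -/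
theorem card_basisIdx_eq_card : (basisIdx K₀ ζ).card = Fintype.card (basisSet K₀ ζ) := by
  classical
  unfold basisIdx
  rw [Finset.card_image_of_injective _ (idx_injective K₀ ζ), Finset.card_univ]

omit [Fintype ι] in
/-- The coordinate at a basis index lies in `K₀[ζ]`. [folklore] -/
theorem apply_mem_genAlg (b : ι) : ζ b ∈ genAlg K₀ ζ := Algebra.subset_adjoin ⟨b, rfl⟩

/-- The basis element sitting at a basis index. [folklore] -/
def bElt {b : ι} (hb : b ∈ basisIdx K₀ ζ) : basisSet K₀ ζ :=
  ⟨⟨ζ b, apply_mem_genAlg K₀ ζ b⟩, by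
    obtain ⟨a, rfl⟩ := (mem_basisIdx_iff K₀ ζ).1 hb
    have : (⟨ζ (idx K₀ ζ a), apply_mem_genAlg K₀ ζ _⟩ : genAlg K₀ ζ) = (a : genAlg K₀ ζ) :=
      Subtype.ext (apply_idx K₀ ζ a)
    rw [this]; exact a.2⟩

/-- `bElt` at a basis index is the basis element with that index. [folklore] -/
theorem idx_bElt {b : ι} (hb : b ∈ basisIdx K₀ ζ) : idx K₀ ζ (bElt K₀ ζ hb) = b := by
  obtain ⟨a, rfl⟩ := (mem_basisIdx_iff K₀ ζ).1 hb
  have : bElt K₀ ζ hb = a := Subtype.ext (Subtype.ext (apply_idx K₀ ζ a))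
  rw [this]

/-- The value of `bElt`. [folklore] -/
@[simp] theorem bvec_bElt {b : ι} (hb : b ∈ basisIdx K₀ ζ) : bvec K₀ ζ (bElt K₀ ζ hb) = ζ b := rfl

/-- Every basis element is `bElt` of its index. [folklore] -/
theorem bElt_idx (a : basisSet K₀ ζ) :
    bElt K₀ ζ ((mem_basisIdx_iff K₀ ζ).2 ⟨a, rfl⟩) = a :=
  idx_injective K₀ ζ (idx_bElt K₀ ζ _)

/-- **`|S| = td(ζ/K₀)`**: the number of basis indices is the Krull dimension of
`K₀[X] ⧸ I_{K₀}(ζ)` (dimension = transcendence degree for affine domains, and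
`K₀[X] ⧸ I_{K₀}(ζ) ≅ K₀[ζ]`). [cite: Matsumura1987, Thm 5.6] -/
theorem card_basisIdx :
    ((((basisIdx K₀ ζ).card : ℕ) : ℕ∞) : WithBot ℕ∞) =
      ringKrullDim (MvPolynomial ι K₀ ⧸ vanishingIdeal K₀ ({ζ} : Set (ι → F))) := by
  classical
  -- `I(ζ) = ker (aeval ζ)` and `K₀[X] ⧸ ker ≅ range = K₀[ζ]`
  set φ := (aeval ζ : MvPolynomial ι K₀ →ₐ[K₀] F) with hφ
  have hker : vanishingIdeal K₀ ({ζ} : Set (ι → F)) = RingHom.ker φ := by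
    ext f; rw [mem_vanishingIdeal_singleton_iff, RingHom.mem_ker]
  haveI : (RingHom.ker φ).IsPrime := RingHom.ker_isPrime _
  haveI : IsDomain (MvPolynomial ι K₀ ⧸ RingHom.ker φ) := Ideal.Quotient.isDomain _
  have e : (MvPolynomial ι K₀ ⧸ RingHom.ker φ) ≃ₐ[K₀] φ.range :=
    (Ideal.quotientEquivAlgOfEq K₀ (AlgHom.ker_rangeRestrict φ).symm).trans
      (Ideal.quotientKerAlgEquivOfSurjective (AlgHom.rangeRestrict_surjective φ))
  have hrange : φ.range = genAlg K₀ ζ := (Algebra.adjoin_range_eq_range_aeval K₀ ζ).symm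
  rw [hker, Literature.RingTheory.KrullDimension.ringKrullDim_eq_trdeg K₀]
  have h1 := congrArg Cardinal.toNat (AlgEquiv.lift_trdeg_eq (R := K₀) e)
  simp only [Cardinal.toNat_lift] at h1
  rw [h1, hrange]
  -- `trdeg K₀ K₀[ζ] = #basisSet = card basisIdx`
  have h3 : Cardinal.mk (basisSet K₀ ζ) = Algebra.trdeg K₀ (genAlg K₀ ζ) :=
    (isTranscendenceBasis_basisSet K₀ ζ).cardinalMk_eq_trdeg
  rw [← h3, Cardinal.mk_fintype, Cardinal.toNat_natCast, card_basisIdx_eq_card]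
  rfl

end Basis

/-! ### Dual derivations of `F` over `K₀` -/

section Dual

variable {F : Type u} [Field F] [CharZero F] (K₀ : Type u) [Field K₀] [CharZero K₀] [Algebra K₀ F]
  {N : ℕ} (ζ : Fin N ⊕ Fin N → F)

/-- The normalising factor of a basis element: `1` for an additive coordinate, the coordinate
itself for a multiplicative one (so that the logarithmic Jacobian becomes the identity).
[folklore] -/
def scale (a : basisSet K₀ ζ) : F :=
  Sum.elim (fun _ => (1 : F)) (fun _ => bvec K₀ ζ a) (idx K₀ ζ a)

omit [CharZero F] [CharZero K₀] in
/-- `scale a = 1` when the index of `a` is additive. [folklore] -/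
theorem scale_of_idx_eq_inl {a : basisSet K₀ ζ} {i : Fin N} (h : idx K₀ ζ a = Sum.inl i) :
    scale K₀ ζ a = 1 := by
  simp [scale, h]

omit [CharZero F] [CharZero K₀] in
/-- `scale a = a` when the index of `a` is multiplicative. [folklore] -/
theorem scale_of_idx_eq_inr {a : basisSet K₀ ζ} {i : Fin N} (h : idx K₀ ζ a = Sum.inr i) :
    scale K₀ ζ a = bvec K₀ ζ a := by
  simp [scale, h]

omit [CharZero F] in
open Classical in
/-- For each basis element `a` there is a `K₀`-derivation `∂ₐ` of `F` with
`∂ₐ b = δ_{ab} · scale b` on the basis. [cite: Rosenlicht1976, Prop. 3] -/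
theorem exists_dualDerivation (a : basisSet K₀ ζ) :
    ∃ δ : Derivation K₀ F F, ∀ b : basisSet K₀ ζ,
      δ (bvec K₀ ζ b) = if a = b then scale K₀ ζ b else 0 := by
  classical
  obtain ⟨δ, hδ⟩ := exists_derivation_of_algebraicIndependent (k := K₀) (K := F)
    (algebraicIndependent_bvec K₀ ζ) (fun b => if a = b then scale K₀ ζ b else 0)
  exact ⟨δ, fun b => hδ b⟩

open Classical in
/-- The dual derivations `∂ₐ` of `F/K₀` (`a` in the chosen basis). [folklore] -/
def dualDerivation (a : basisSet K₀ ζ) : Derivation K₀ F F :=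
  (exists_dualDerivation K₀ ζ a).choose

omit [CharZero F] in
open Classical in
/-- `∂ₐ b = δ_{ab} · scale b` on basis elements. [folklore] -/
theorem dualDerivation_apply_basis (a b : basisSet K₀ ζ) :
    dualDerivation K₀ ζ a (bvec K₀ ζ b) = if a = b then scale K₀ ζ b else 0 :=
  (exists_dualDerivation K₀ ζ a).choose_spec b

omit [CharZero F] [CharZero K₀] in
/-- Basis elements are non-zero. [folklore] -/
theorem bvec_ne_zero (b : basisSet K₀ ζ) : bvec K₀ ζ b ≠ 0 :=
  (algebraicIndependent_bvec K₀ ζ).ne_zero b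

omit [CharZero K₀] in
/-- The normalising factors are non-zero. [folklore] -/
theorem scale_ne_zero (b : basisSet K₀ ζ) : scale K₀ ζ b ≠ 0 := by
  unfold scale
  cases h : idx K₀ ζ b with
  | inl i => simp
  | inr i => simpa using bvec_ne_zero K₀ ζ b

omit [CharZero K₀] in
/-- A `K₀`-derivation of `F` vanishing on the basis vanishes on `K₀[ζ]`: every element of `K₀[ζ]`
is algebraic over `K₀[basis]` (differentiate a minimal relation, Rosenlicht 1976, Prop. 3).
[cite: Rosenlicht1976, Prop. 3] -/
theorem derivation_eq_zero_of_mem_genAlg (δ : Derivation K₀ F F)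
    (hδ : ∀ b : basisSet K₀ ζ, δ (bvec K₀ ζ b) = 0) {z : F} (hz : z ∈ genAlg K₀ ζ) : δ z = 0 := by
  classical
  set A : Subalgebra K₀ F := genAlg K₀ ζ with hA
  set u : Set A := basisSet K₀ ζ with hu
  have hub : IsTranscendenceBasis K₀ ((↑) : u → A) := isTranscendenceBasis_basisSet K₀ ζ
  set R₁ : Subalgebra K₀ A := Algebra.adjoin K₀ (range ((↑) : u → A)) with hR₁
  -- `δ` vanishes on `K₀[basis] ⊆ F`
  have hRu : ∀ a : A, a ∈ R₁ → δ (a : F) ∈ (⊥ : Submodule F F) := by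
    intro a ha
    have ha' : (a : F) ∈ Algebra.adjoin K₀ (((↑) : A → F) '' u) := by
      have : (a : F) ∈ (Algebra.adjoin K₀ (range ((↑) : u → A))).map A.val := ⟨a, ha, rfl⟩
      rw [← Algebra.adjoin_image] at this
      convert this using 2
      ext x
      simp only [mem_image, mem_range, Subalgebra.coe_val]
      constructor
      · rintro ⟨b, hb, rfl⟩; exact ⟨b, ⟨⟨b, hb⟩, rfl⟩, rfl⟩
      · rintro ⟨b, ⟨i, rfl⟩, rfl⟩; exact ⟨i, i.2, rfl⟩
    have hmem := Rosenlicht.derivation_apply_mem_span_of_mem_adjoin δ _ ha'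
    have hspan : Submodule.span F (δ '' (((↑) : A → F) '' u)) = ⊥ := by
      rw [Submodule.span_eq_bot]
      rintro _ ⟨_, ⟨b, hb, rfl⟩, rfl⟩
      exact hδ ⟨b, hb⟩
    rwa [hspan] at hmem
  -- `z` is algebraic over `K₀[basis]`
  have halg : IsAlgebraic R₁ (⟨z, hz⟩ : A) := hub.isAlgebraic.isAlgebraic _
  obtain ⟨p, hp0, hpx⟩ := halg
  have hφinj : Function.Injective ((algebraMap A F).comp (algebraMap R₁ A)) :=
    fun a b h => Subtype.ext (Subtype.ext h)
  have hp' := (Polynomial.map_ne_zero_iff hφinj).mpr hp0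
  have hpx' : (p.map ((algebraMap A F).comp (algebraMap R₁ A))).eval z = 0 := by
    have hs' : algebraMap A F ⟨z, hz⟩ = z := rfl
    have := congrArg (algebraMap A F) hpx
    rw [map_zero, Polynomial.aeval_def, Polynomial.hom_eval₂, hs'] at this
    rwa [Polynomial.eval_map]
  have h := Rosenlicht.derivation_mem_of_eval_eq_zero δ ⊥ hp' (fun i => ?_) hpx'
  · simpa using h
  · rw [Polynomial.coeff_map]
    exact hRu _ (p.coeff i).2

/-- **Constants of the dual derivations are algebraic**: an element of the field `K₀(ζ)` killed
by every `∂ₐ` is algebraic over `K₀` (a transcendental element is moved by some `K₀`-derivation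
of `F`, which after correction by the `∂ₐ` vanishes on the basis, hence on `K₀(ζ)`).
[cite: Rosenlicht1976, Prop. 3] -/
theorem isAlgebraic_of_forall_dualDerivation_eq_zero {z : F}
    (hzmem : z ∈ IntermediateField.adjoin K₀ (range ζ))
    (hz : ∀ a, dualDerivation K₀ ζ a z = 0) : IsAlgebraic K₀ z := by
  classical
  by_contra hzt
  have hzt' : Transcendental K₀ z := hzt
  obtain ⟨δ, hδ1⟩ := exists_derivation_eq_one_of_transcendental (k := K₀) (K := F) hzt'
  suffices h : δ z = 0 by rw [h] at hδ1; exact zero_ne_one hδ1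
  set c : basisSet K₀ ζ → F := fun a => δ (bvec K₀ ζ a) * (scale K₀ ζ a)⁻¹ with hc
  have hsum : ∀ w, (∑ a, c a • dualDerivation K₀ ζ a) w = ∑ a, c a * dualDerivation K₀ ζ a w := by
    intro w
    have h := congrFun (map_sum Derivation.coeFnAddMonoidHom
      (fun a => c a • dualDerivation K₀ ζ a) Finset.univ) w
    rw [Derivation.coeFnAddMonoidHom_apply, Finset.sum_apply] at h
    rw [h]
    refine Finset.sum_congr rfl fun a _ => ?_
    rw [Derivation.coeFnAddMonoidHom_apply, Derivation.coe_smul, Pi.smul_apply, smul_eq_mul]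
  set δ' : Derivation K₀ F F := δ - ∑ a, c a • dualDerivation K₀ ζ a with hδ'
  -- `δ'` vanishes on the basis
  have hδ'e : ∀ b, δ' (bvec K₀ ζ b) = 0 := by
    intro b
    rw [hδ', Derivation.sub_apply, hsum, sub_eq_zero]
    have : ∀ a, c a * dualDerivation K₀ ζ a (bvec K₀ ζ b) = if a = b then δ (bvec K₀ ζ b) else 0 := by
      intro a
      rw [dualDerivation_apply_basis]
      split_ifs with hab
      · subst hab
        rw [hc]
        show δ (bvec K₀ ζ a) * (scale K₀ ζ a)⁻¹ * scale K₀ ζ a = δ (bvec K₀ ζ a)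
        rw [inv_mul_cancel_right₀ (scale_ne_zero K₀ ζ a)]
      · rw [mul_zero]
    simp only [this, Finset.sum_ite_eq', Finset.mem_univ, if_true]
  -- hence on `K₀[ζ]`, hence on the field `K₀(ζ)`
  have hgen : ∀ s ∈ range ζ, δ' s = 0 := by
    rintro _ ⟨b, rfl⟩
    exact derivation_eq_zero_of_mem_genAlg K₀ ζ δ' hδ'e (apply_mem_genAlg K₀ ζ b)
  have hz' : δ' z = 0 :=
    derivation_eq_zero_on_adjoin δ' (fun r => δ'.map_algebraMap r) hgen hzmem
  rw [hδ', Derivation.sub_apply, hsum, sub_eq_zero] at hz'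
  rw [hz']
  exact Finset.sum_eq_zero fun a _ => by rw [hz a, mul_zero]

end Dual

/-! ### The field of formal logarithms `F(x₁, …, x_N)` and its derivations -/

section Log

variable (F : Type u) [Field F] (N : ℕ)

/-- The field `LogF F N = F(x₁, …, x_N)` of rational functions over `F` in `N` fresh indeterminates
(formal logarithms). The same type serves every point `ζ`. [folklore] -/
abbrev LogF : Type u := FractionRing (MvPolynomial (Fin N) F)

variable {F N}

/-- The formal logarithms `xᵢ ∈ LogF F N`. [folklore] -/
def logX (i : Fin N) : LogF F N := algebraMap (MvPolynomial (Fin N) F) (LogF F N) (X i)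

/-- The `xᵢ` are algebraically independent over `F`. [folklore] -/
theorem algebraicIndependent_logX : AlgebraicIndependent F (logX (F := F) (N := N)) :=
  (algebraicIndependent_X (Fin N) F).map'
    (f := IsScalarTower.toAlgHom F (MvPolynomial (Fin N) F) (LogF F N))
    (IsFractionRing.injective (MvPolynomial (Fin N) F) (LogF F N))

variable [CharZero F] (K₀ : Type u) [Field K₀] [CharZero K₀] [Algebra K₀ F] (ζ : Fin N ⊕ Fin N → F)

omit [CharZero F] [CharZero K₀] in
/-- The `K₀`-algebra structure of `LogF F N` factors through `F` (Mathlib's instances on the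
localisation). [folklore] -/
theorem algebraMap_logF_apply (c : K₀) :
    algebraMap K₀ (LogF F N) c = algebraMap F (LogF F N) (algebraMap K₀ F c) :=
  IsScalarTower.algebraMap_apply K₀ F (LogF F N) c

/-- `LogF F N` has characteristic zero. [folklore] -/
instance charZero_logF : CharZero (LogF F N) :=
  charZero_of_injective_algebraMap (algebraMap F (LogF F N)).injective

/-- The point `ζ` viewed in `LogF F N`. [folklore] -/
def zetaL (j : Fin N ⊕ Fin N) : LogF F N := algebraMap F (LogF F N) (ζ j)

omit [CharZero F] in
/-- Multiplicative coordinates stay non-zero in `LogF F N`. [folklore] -/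
theorem zetaL_inr_ne_zero {i : Fin N} (h : ζ (Sum.inr i) ≠ 0) : zetaL ζ (Sum.inr i) ≠ 0 := by
  rw [zetaL, map_ne_zero_iff _ (algebraMap F (LogF F N)).injective]
  exact h

omit [CharZero K₀] in
/-- The partial derivatives `∂/∂xᵢ` of `F(x)/F`. [cite: Rosenlicht1976, Prop. 3] -/
theorem exists_coordDerivation (i : Fin N) :
    ∃ E : Derivation F (LogF F N) (LogF F N), ∀ l, E (logX l) = if l = i then 1 else 0 := by
  classical
  exact exists_derivation_of_algebraicIndependent (k := F) (K := LogF F N)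
    algebraicIndependent_logX _

omit [CharZero K₀] in
/-- **Extension with prescribed values on the logarithms**: a `K₀`-derivation `δ` of `F` extends to
a `K₀`-derivation of `F(x)` taking arbitrary prescribed values `wₗ` at the `xₗ` (extend `δ` anyhow,
then correct by `Σₗ (wₗ - ·) ∂/∂xₗ`). [cite: Rosenlicht1976, Prop. 3] -/
theorem exists_extension (δ : Derivation K₀ F F) (w : Fin N → LogF F N) :
    ∃ Dδ : Derivation K₀ (LogF F N) (LogF F N),
      (∀ z, Dδ (algebraMap F (LogF F N) z) = algebraMap F (LogF F N) (δ z)) ∧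
      ∀ l, Dδ (logX l) = w l := by
  classical
  obtain ⟨d₀, hd₀⟩ := Derivation.exists_extension_of_charZero (R := K₀) (F := F)
    (T := LogF F N) (M := LogF F N) ((Algebra.linearMap F (LogF F N)).compDer δ)
  choose E hE using exists_coordDerivation (F := F) (N := N)
  refine ⟨d₀ + ∑ i, (w i - d₀ (logX i)) • (E i).restrictScalars K₀, fun z => ?_, fun l => ?_⟩
  · rw [Derivation.add_apply, hd₀]
    have : (∑ i, (w i - d₀ (logX i)) • (E i).restrictScalars K₀)
        (algebraMap F (LogF F N) z) = 0 := by
      have h := congrFun (map_sum Derivation.coeFnAddMonoidHom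
        (fun i => (w i - d₀ (logX i)) • (E i).restrictScalars K₀) Finset.univ)
        (algebraMap F (LogF F N) z)
      rw [Derivation.coeFnAddMonoidHom_apply, Finset.sum_apply] at h
      rw [h]
      refine Finset.sum_eq_zero fun i _ => ?_
      rw [Derivation.coeFnAddMonoidHom_apply, Derivation.coe_smul, Pi.smul_apply,
        Derivation.restrictScalars_apply, Derivation.map_algebraMap, smul_zero]
    rw [this, add_zero]
    rfl
  · rw [Derivation.add_apply]
    have : (∑ i, (w i - d₀ (logX i)) • (E i).restrictScalars K₀) (logX l) = w l - d₀ (logX l) := by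
      have h := congrFun (map_sum Derivation.coeFnAddMonoidHom
        (fun i => (w i - d₀ (logX i)) • (E i).restrictScalars K₀) Finset.univ) (logX l)
      rw [Derivation.coeFnAddMonoidHom_apply, Finset.sum_apply] at h
      rw [h]
      have h2 : ∀ i, (Derivation.coeFnAddMonoidHom ((w i - d₀ (logX i)) • (E i).restrictScalars K₀))
          (logX l) = if l = i then w i - d₀ (logX i) else 0 := fun i => by
        rw [Derivation.coeFnAddMonoidHom_apply, Derivation.coe_smul, Pi.smul_apply,
          Derivation.restrictScalars_apply, hE i l, smul_eq_mul]
        split_ifs <;> simp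
      simp only [h2, Finset.sum_ite_eq, Finset.mem_univ, if_true]
    rw [this, add_sub_cancel]

/-- The extension of the dual derivation `∂ₐ` of `F` to `F(x)`, normalised by
`D xₗ = ∂ₐ(ζ₂ₗ) / ζ₂ₗ` ("`ζ₂ = exp x`"). [folklore] -/
def extDerivation (a : basisSet K₀ ζ) : Derivation K₀ (LogF F N) (LogF F N) :=
  (exists_extension K₀ (dualDerivation K₀ ζ a)
    (fun l => algebraMap F (LogF F N) (dualDerivation K₀ ζ a (ζ (Sum.inr l))) *
      (zetaL ζ (Sum.inr l))⁻¹)).choose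

/-- `extDerivation a` extends `∂ₐ`. [folklore] -/
theorem extDerivation_algebraMap (a : basisSet K₀ ζ) (z : F) :
    extDerivation K₀ ζ a (algebraMap F (LogF F N) z) =
      algebraMap F (LogF F N) (dualDerivation K₀ ζ a z) :=
  (exists_extension K₀ (dualDerivation K₀ ζ a) _).choose_spec.1 z

/-- The values of `extDerivation a` on the logarithms. [folklore] -/
theorem extDerivation_logX (a : basisSet K₀ ζ) (l : Fin N) :
    extDerivation K₀ ζ a (logX l) =
      algebraMap F (LogF F N) (dualDerivation K₀ ζ a (ζ (Sum.inr l))) * (zetaL ζ (Sum.inr l))⁻¹ :=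
  (exists_extension K₀ (dualDerivation K₀ ζ a) _).choose_spec.2 l

/-- **The derivations `D_c`** (`c ∈ Fin N ⊕ Fin N`) of `F(x)`: `D_c` extends `∂_{ζ_c}` for `c` a
basis index, and `D_c = 0` otherwise. [folklore] -/
def logDer (c : Fin N ⊕ Fin N) : Derivation K₀ (LogF F N) (LogF F N) := by
  classical
  exact if h : c ∈ basisIdx K₀ ζ then extDerivation K₀ ζ (bElt K₀ ζ h) else 0

/-- `D_c` for a basis index `c`. [folklore] -/
theorem logDer_of_mem {c : Fin N ⊕ Fin N} (h : c ∈ basisIdx K₀ ζ) :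
    logDer K₀ ζ c = extDerivation K₀ ζ (bElt K₀ ζ h) := by
  classical
  simp [logDer, h]

/-- `D_c = 0` for a non-basis index `c`. [folklore] -/
theorem logDer_of_not_mem {c : Fin N ⊕ Fin N} (h : c ∉ basisIdx K₀ ζ) : logDer K₀ ζ c = 0 := by
  classical
  simp [logDer, h]

/-- On `F`, `D_c` is `∂` (basis index) or `0`; in either case `D_c` maps `F` into `F`.
[folklore] -/
theorem logDer_algebraMap_of_mem {c : Fin N ⊕ Fin N} (h : c ∈ basisIdx K₀ ζ) (z : F) :
    logDer K₀ ζ c (algebraMap F (LogF F N) z) =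
      algebraMap F (LogF F N) (dualDerivation K₀ ζ (bElt K₀ ζ h) z) := by
  rw [logDer_of_mem K₀ ζ h, extDerivation_algebraMap]

/-- `D_c` kills `K₀`. [folklore] -/
theorem logDer_algebraMap_base (c : Fin N ⊕ Fin N) (k : K₀) :
    logDer K₀ ζ c (algebraMap K₀ (LogF F N) k) = 0 :=
  (logDer K₀ ζ c).map_algebraMap k

/-- **The exponential differential equation** `D_c ζ₂ᵢ = ζ₂ᵢ · D_c xᵢ` (for `ζ₂ᵢ ≠ 0`).
[cite: Kirby2009, §3] -/
theorem logDer_exp (hζ : ∀ i, ζ (Sum.inr i) ≠ 0) (c : Fin N ⊕ Fin N) (i : Fin N) :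
    logDer K₀ ζ c (zetaL ζ (Sum.inr i)) = zetaL ζ (Sum.inr i) * logDer K₀ ζ c (logX i) := by
  by_cases h : c ∈ basisIdx K₀ ζ
  · rw [zetaL, logDer_algebraMap_of_mem K₀ ζ h, logDer_of_mem K₀ ζ h, extDerivation_logX, ← zetaL,
      mul_comm (algebraMap _ _ _) (zetaL ζ (Sum.inr i))⁻¹, ← mul_assoc,
      mul_inv_cancel₀ (zetaL_inr_ne_zero ζ (hζ i)), one_mul]
  · rw [logDer_of_not_mem K₀ ζ h, Derivation.zero_apply, Derivation.zero_apply, mul_zero]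

/-- The "logarithmic coordinates" of `ζ`: the additive coordinates themselves and the formal
logarithms of the multiplicative ones. [folklore] -/
def logCoord : Fin N ⊕ Fin N → LogF F N :=
  Sum.elim (fun i => zetaL ζ (Sum.inl i)) (fun i => logX i)

omit [CharZero F] in
/-- Additive logarithmic coordinates. [folklore] -/
@[simp] theorem logCoord_inl (i : Fin N) : logCoord ζ (Sum.inl i) = zetaL ζ (Sum.inl i) := rfl

omit [CharZero F] in
/-- Multiplicative logarithmic coordinates. [folklore] -/
@[simp] theorem logCoord_inr (i : Fin N) : logCoord ζ (Sum.inr i) = logX (F := F) i := rfl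

/-- **The Jacobian is the identity on the basis indices**: `D_c (logCoord b) = δ_{bc}` for `b` a
basis index (this is what the normalisation `scale` achieves). [cite: Kirby2009, Thm 4.6 (proof)] -/
theorem logDer_jac (hζ : ∀ i, ζ (Sum.inr i) ≠ 0) {b : Fin N ⊕ Fin N} (hb : b ∈ basisIdx K₀ ζ)
    (c : Fin N ⊕ Fin N) : logDer K₀ ζ c (logCoord ζ b) = if b = c then 1 else 0 := by
  classical
  by_cases hc : c ∈ basisIdx K₀ ζ
  · have hval : ∀ b' : Fin N ⊕ Fin N, ∀ hb' : b' ∈ basisIdx K₀ ζ,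
        dualDerivation K₀ ζ (bElt K₀ ζ hc) (ζ b') =
          if bElt K₀ ζ hc = bElt K₀ ζ hb' then scale K₀ ζ (bElt K₀ ζ hb') else 0 := by
      intro b' hb'
      have : ζ b' = bvec K₀ ζ (bElt K₀ ζ hb') := rfl
      rw [this, dualDerivation_apply_basis]
    have hiff : bElt K₀ ζ hc = bElt K₀ ζ hb ↔ b = c := by
      constructor
      · intro h
        have := congrArg (idx K₀ ζ) h
        rw [idx_bElt, idx_bElt] at this
        exact this.symm
      · rintro rfl; rfl
    rcases b with i | i
    · -- additive coordinate: `scale = 1`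
      rw [logCoord_inl, zetaL, logDer_algebraMap_of_mem K₀ ζ hc, hval _ hb]
      by_cases hbc : Sum.inl i = c
      · rw [if_pos (hiff.2 hbc), if_pos hbc, scale_of_idx_eq_inl K₀ ζ (idx_bElt K₀ ζ hb), map_one]
      · rw [if_neg (fun h => hbc (hiff.1 h)), if_neg hbc, map_zero]
    · -- multiplicative coordinate: `scale = ζ₂ᵢ`
      rw [logCoord_inr, logDer_of_mem K₀ ζ hc, extDerivation_logX, hval _ hb]
      by_cases hbc : Sum.inr i = c
      · rw [if_pos (hiff.2 hbc), if_pos hbc, scale_of_idx_eq_inr K₀ ζ (idx_bElt K₀ ζ hb), bvec_bElt,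
          ← zetaL, mul_inv_cancel₀ (zetaL_inr_ne_zero ζ (hζ i))]
      · rw [if_neg (fun h => hbc (hiff.1 h)), if_neg hbc, map_zero, zero_mul]
  · have hbc : b ≠ c := fun h => hc (h ▸ hb)
    rw [logDer_of_not_mem K₀ ζ hc, Derivation.zero_apply, if_neg hbc]

/-- **Constant elements of `K₀(ζ)` are algebraic over `K₀`**: if `z ∈ K₀(ζ)` and all `D_c` kill the
image of `z` in `F(x)`, then `z` is algebraic over `K₀`. [cite: Kirby2009, Thm 4.6 (proof)] -/
theorem isAlgebraic_of_forall_logDer_eq_zero {z : F} (hzmem : z ∈ IntermediateField.adjoin K₀ (range ζ))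
    (hz : ∀ c, logDer K₀ ζ c (algebraMap F (LogF F N) z) = 0) : IsAlgebraic K₀ z := by
  refine isAlgebraic_of_forall_dualDerivation_eq_zero K₀ ζ hzmem fun a => ?_
  have hc : idx K₀ ζ a ∈ basisIdx K₀ ζ := (mem_basisIdx_iff K₀ ζ).2 ⟨a, rfl⟩
  have h := hz (idx K₀ ζ a)
  rw [logDer_algebraMap_of_mem K₀ ζ hc, bElt_idx,
    map_eq_zero_iff _ (algebraMap F (LogF F N)).injective] at h
  exact h

/-- **Constant Laurent monomials in `ζ₂` are algebraic over `K₀`**: if `∏ ζ₂ᵢ^{mᵢ}` (viewed in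
`F(x)`) is killed by all `D_c`, then `∏ ζ₂ᵢ^{mᵢ} ∈ F` is algebraic over `K₀`.
[cite: Kirby2009, Thm 4.6 (proof)] -/
theorem isAlgebraic_of_forall_logDer_prod_zpow (m : Fin N → ℤ)
    (hm : ∀ c, logDer K₀ ζ c (∏ i, zetaL ζ (Sum.inr i) ^ m i) = 0) :
    IsAlgebraic K₀ (∏ i, ζ (Sum.inr i) ^ m i) := by
  have hmap : (∏ i, zetaL ζ (Sum.inr i) ^ m i) = algebraMap F (LogF F N) (∏ i, ζ (Sum.inr i) ^ m i) := by
    simp only [map_prod, map_zpow₀, zetaL]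
  refine isAlgebraic_of_forall_logDer_eq_zero K₀ ζ ?_ (fun c => by rw [← hmap]; exact hm c)
  refine prod_mem fun i _ => zpow_mem (IntermediateField.subset_adjoin K₀ (range ζ) ⟨Sum.inr i, rfl⟩) _

end Log

end Literature.NumberTheory.Transcendental.Prop115
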